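import Summits.AnomalousDissipation.AnomalousDissipation.Theses.TaylorCertificates
import Summits.AnomalousDissipation.AnomalousDissipation.Theorems.KolmogorovFloor.Negative.BelowTaylor

/-!
# Sketch (crux-ideate round 2, ideator 5) — `lacunary-frame-closure` for the crux
`TaylorCertificates.KolmogorovFloor` (stmt-AnomalousDissipation-14030): THEOREM C made a theorem

NEGATIVE lever (companion of `idea-lacunary-frame-closure.md` and memo `LACUNARY-FRAME-r2-5.md`).
The typed negative skeleton `Cruxes/KolmogorovFloor/Lines/dressed-laminar-ray.lean` (crux-plan r1) refutes the
crux from five stubs; its stubs 3–5 (`stub_axisFrameResponse`, `stub_skewFrameResponse`, `stub_smoothForceRay`)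
are the existence of the inviscid linear response in axis frames / skew frames / `ν`-dependent frames, the last
one labelled CONJECTURE-WITH-RECIPE with ONE named residual risk (uniform non-resonance over all mode lines of a
high-frequency frame). This file types the three elementary lemmas that remove that risk and collapse stubs 3–5
into ONE frame-generic response statement:

* `lacunary_nonresonant` — for `ξ = (P,Q,R)` with `P > L²`, `Q > 2LP`, `R > 2L(P+Q)` every mode `0 < k·k ≤ L²`
  has `k·k < 2|k·ξ|`, i.e. (by `resonanceCriterion`) NO mode line `k + ℤξ` of a degree-`L` force is resonant
  (`t = ±1` is the only possible resonance once `ξ·ξ > 4 k·k`); PROVED below (integer arithmetic).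
* `ExplicitAdmissibleFrame` — `e := a·(Q,−P,0) + (R,0,−P)`, `a := L·|ξ|₁·(Q+R+2P) + 1`, has `ξ·e = 0` and
  `k·e ≠ 0 ≠ k·(ξ × e)` for every off-line `k` with `k·k ≤ L²` (two-line proof: the `a`-term dominates unless its
  coefficient vanishes, and both coefficients vanish only on the line `ℝξ`); and `ξ·ξ > L²` empties the line.
* `QuantitativeLacunaryResponseStatement` — THEOREM B in that ONE explicit frame with constants polynomial in
  `L·(1 + Σ_{|k|≤L}‖f̂(k)‖)`: per mode line the Squire-reduced Rayleigh operator `(∂_θ+iρ_ℓ)² + ω_ℓ²` has integer-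
  normalised eigenvalues `(4π²/ξ·ξ)·I_j`, `I_j = ξ·ξ(1−j²) − k·k − 2j(k·ξ) ∈ ℤ ∖ {0}` ⇒ `‖inverse‖ ≤ ξ·ξ/4π²` and the
  2×2 critical-layer determinant is `≥ c/(ξ·ξ)²` (closed form `G(½)/G(0) = cos(ρ/2)/cos(ω/2)`, TRIAGE-r1-3 (Y2c)).
  NUMERICALLY CORROBORATED this session (toy/skew_ray_lu.py, pure python, banded LU with decay closure): L²
  response with flat log-layer tail `|j|‖b̂_j‖ → const` and truncation-defect law `Jc²·defect → const` in the
  lacunary frame `ξ = (5,21,105)`, a generic skew frame `(9,13,31)`, the explicit big-`e` frame, a `t = 1`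
  RESONANT line and a `μ̃ = 0` cross line alike; failure exactly on inadmissible lines (`k·e = 0` or `k·n = 0`).
* `UniversalRayStatement` — the ray family for EVERY admissible force (polynomial or not) from the quantitative
  response by `ν`-dependent truncation `L = ⌈ν^{-σ}⌉` (tail of `f̂` is `O(L^{-∞})`, constants `ν^{-O(σ)}` against
  the spare `ν^{1/8}` of THEOREM A); composition `kolmogorovFloor_false_of_lacunary` PROVED (logic):
  `EndgameStatement → UniversalRayStatement → QuantitativeLacunaryResponseStatement → ¬ KolmogorovFloor`.
* `EmptyLineKillStatement` — the FIXED-frame corollary with `ν`-INDEPENDENT constants for the non-polynomial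
  class "`f̂` vanishes on one coordinate axis" via the `√2`-polarised Kolmogorov shear
  `sin(2πx₂)(e₁ + √2 e₃)/√3` (bad set = the axis only: `|k₁ + √2 k₃| ≥ 1/(3(|k₁|+|k₃|))`).

Definitions of §A are copied verbatim from `Lines/dressed-laminar-ray.lean` (which copies SketchIdeator3) so the
file is self-contained and the statements are literally compatible with the registered negative skeleton.
-/

noncomputable section

set_option linter.dupNamespace false

open MeasureTheory UnitAddTorus Matrix
open scoped InnerProductSpace ENNReal BigOperators

namespace Summit.AnomalousDissipation.AnomalousDissipation.Cruxes.KolmogorovFloor.Ideate5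

open Literature.Analysis.FunctionSpaces Literature.Analysis.FluidPDE
open Summit.AnomalousDissipation.AnomalousDissipation.Theses.TaylorCertificates

local notation "𝕋³" => UnitAddTorus (Fin 3)
local notation "E³" => EuclideanSpace ℝ (Fin 3)
local notation "L2T" => Lp (EuclideanSpace ℝ (Fin 3)) 2 (volume : Measure (UnitAddTorus (Fin 3)))

/-! ## §A  Copied interface (Lines/dressed-laminar-ray.lean §A–§D) -/

def FloorClassAtFor (β : ℝ) (f : 𝕋³ → E³) : Prop :=
  ∃ (ε₀ C Θ ν₀ : ℝ), 0 < ε₀ ∧ 0 < ν₀ ∧ ∀ ν : ℝ, 0 < ν → ν < ν₀ →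
    ∃ (N : ℕ) (Φ₁ : Torus.CylindricalTest (Fin 3)) (θ₁ : ℝ), (N : ℝ) ≤ C * ν ^ (-β) ∧
    (∀ i, Torus.fourierTruncate N (Φ₁.g i) = Φ₁.g i) ∧ -Θ ≤ θ₁ ∧ θ₁ ≤ 0 ∧
    ∀ u : Torus.energySpace (Fin 3),
      let uf : 𝕋³ → E³ := ((u : L2T) : 𝕋³ → E³);
      let D : ℝ := ν * (Torus.eGradNormSq uf).toReal;
      let P : ℝ := Torus.pairing (u : L2T) f - D;
      Torus.eGradNormSq uf ≠ ⊤ → ‖u‖ ^ 2 ≤ 16 * (∫ x, ‖f x‖ ^ 2) / ν ^ 2 →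
      ε₀ ≤ D + Torus.nsGeneratorPairing ν f u (Φ₁.grad u) + 2 * θ₁ * P

theorem kolmogorovFloor_iff :
    KolmogorovFloor ↔ ∃ f : 𝕋³ → E³, Torus.IsSmooth f ∧ Torus.IsDivFree f ∧ Torus.HasZeroMean f ∧
      FloorClassAtFor (3 / 4) f :=
  Iff.rfl

def FloorKillAtFor (β : ℝ) (f : 𝕋³ → E³) : Prop :=
  ∀ (ε₀ C Θ ν₀ : ℝ), 0 < ε₀ → 0 < ν₀ → ∃ ν : ℝ, 0 < ν ∧ ν < ν₀ ∧
    ∀ (N : ℕ) (Φ₁ : Torus.CylindricalTest (Fin 3)) (θ₁ : ℝ), (N : ℝ) ≤ C * ν ^ (-β) →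
    (∀ i, Torus.fourierTruncate N (Φ₁.g i) = Φ₁.g i) → -Θ ≤ θ₁ → θ₁ ≤ 0 →
    ∃ u : Torus.energySpace (Fin 3),
      let uf : 𝕋³ → E³ := ((u : L2T) : 𝕋³ → E³);
      let D : ℝ := ν * (Torus.eGradNormSq uf).toReal;
      let P : ℝ := Torus.pairing (u : L2T) f - D;
      Torus.eGradNormSq uf ≠ ⊤ ∧ ‖u‖ ^ 2 ≤ 16 * (∫ x, ‖f x‖ ^ 2) / ν ^ 2 ∧
      D + Torus.nsGeneratorPairing ν f u (Φ₁.grad u) + 2 * θ₁ * P < ε₀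

theorem not_floorClassAtFor_of_kill {β : ℝ} {f : 𝕋³ → E³} (hK : FloorKillAtFor β f) :
    ¬ FloorClassAtFor β f := by
  rintro ⟨ε₀, C, Θ, ν₀, hε₀, hν₀, h⟩
  obtain ⟨ν, hν, hνν₀, hkill⟩ := hK ε₀ C Θ ν₀ hε₀ hν₀
  obtain ⟨N, Φ₁, θ₁, hN, hΦ₁, hθ₁, hθ₁', hu⟩ := h ν hν hνν₀
  obtain ⟨u, hfin, hball, hlt⟩ := hkill N Φ₁ θ₁ hN hΦ₁ hθ₁ hθ₁'
  exact absurd (hu u hfin hball) (not_le.mpr hlt)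

theorem not_kolmogorovFloor_of_kill
    (hK : ∀ f : 𝕋³ → E³, Torus.IsSmooth f → Torus.IsDivFree f → Torus.HasZeroMean f →
      FloorKillAtFor (3 / 4) f) : ¬ KolmogorovFloor := by
  rintro ⟨f, hfs, hfd, hfz, hfloor⟩
  exact not_floorClassAtFor_of_kill (hK f hfs hfd hfz) hfloor

def slopeSum (D : ℕ) (w : 𝕋³ → E³) : ℝ :=
  ∑ k ∈ Torus.freqBall D, Real.sqrt (Torus.freqNormSq k) * ‖mFourierCoeff (EuclideanSpace.complexify ∘ w) k‖

def SlopeLE (W : 𝕋³ → E³) (M : ℝ) : Prop :=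
  ∀ k : Fin 3 → ℤ, Real.sqrt (Torus.freqNormSq k) * ‖mFourierCoeff (EuclideanSpace.complexify ∘ W) k‖ ≤ M

/-- Approximate linear response WITH AN EXPLICIT CONSTANT `Cb` (the body of ideator 3's
`ApproxLinearResponse`, the `∃ Cb` removed — needed to track the polynomial dependence on the frame). -/
def ApproxLinearResponseWith (f U : 𝕋³ → E³) (Cb : ℝ) : Prop :=
  ∀ K : ℕ, 1 ≤ K → ∃ b : 𝕋³ → E³,
    Torus.IsSmooth b ∧ Torus.IsDivFree b ∧ Torus.HasZeroMean b ∧ Torus.fourierTruncate K b = b ∧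
    (∫ x, ‖b x‖ ^ 2) ≤ Cb ∧ slopeSum K b ≤ Cb * K ∧ Torus.gradNormSq b ≤ Cb * K ∧
    ∀ (D : ℕ) (W : 𝕋³ → E³) (M : ℝ), Torus.IsSmooth W → Torus.IsDivFree W → Torus.HasZeroMean W →
      Torus.fourierTruncate D W = W → SlopeLE W M →
      |∫ x, ⟪Torus.convect U b x + Torus.convect b U x - f x, W x⟫_ℝ| ≤ Cb / K * M ∧
      |∫ x, ⟪Torus.convect b b x, W x⟫_ℝ| ≤ Cb * (1 + Real.log K) * M

def ApproxLinearResponse (f U : 𝕋³ → E³) : Prop := ∃ Cb : ℝ, ApproxLinearResponseWith f U Cb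

def RayFamily (β : ℝ) (f : 𝕋³ → E³) : Prop :=
  0 < (∫ x, ‖f x‖ ^ 2) →
  ∀ (C Θ ε ν₀ : ℝ), 0 ≤ C → 0 ≤ Θ → 0 < ε → 0 < ν₀ →
    ∃ ν : ℝ, 0 < ν ∧ ν < ν₀ ∧ ν < 1 ∧
    ∃ (Λ : ℕ) (a : 𝕋³ → E³) (den τ : ℝ),
      Torus.IsSmooth a ∧ Torus.IsDivFree a ∧ Torus.HasZeroMean a ∧ Torus.fourierTruncate Λ a = a ∧
      (∀ k : Fin 3 → ℤ, (Λ : ℝ) ^ 2 < Torus.freqNormSq k →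
        ‖mFourierCoeff (EuclideanSpace.complexify ∘ f) k‖ ≤ τ) ∧
      0 ≤ τ ∧ Θ * τ ≤ ε ∧ 0 ≤ den ∧ den ≤ ε ∧
      (∫ x, ‖a x‖ ^ 2) + 1 ≤ 16 * (∫ x, ‖f x‖ ^ 2) / ν ^ 2 ∧
      (1 + 2 * Θ) * (ν * Torus.gradNormSq a) + 2 * Θ * |∫ x, ⟪a x, f x⟫_ℝ| ≤ ε ∧
      den * ((1 + 2 * Θ) * ν * (C * ν ^ (-β) + (Λ : ℝ) + 1) ^ 2) ≤ ε ∧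
      ∀ (N : ℕ) (W : 𝕋³ → E³) (M : ℝ), (N : ℝ) ≤ C * ν ^ (-β) →
        Torus.IsSmooth W → Torus.IsDivFree W → Torus.HasZeroMean W → Torus.fourierTruncate N W = W →
        SlopeLE W M →
        |(∫ x, ⟪f x, W x⟫_ℝ) + ν * (∫ x, ⟪a x, Torus.laplacian W x⟫_ℝ) +
            ∫ x, ⟪Torus.fderiv W x (a x), a x⟫_ℝ| ≤ den * M

/-- Stub 1 of the negative skeleton (THEOREM A endgame), verbatim. -/
def EndgameStatement : Prop :=
  ∀ (β : ℝ) (f : 𝕋³ → E³), Torus.IsSmooth f → Torus.IsDivFree f → Torus.HasZeroMean f →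
    RayFamily β f → FloorKillAtFor β f

/-! ## §B  The three elementary frame lemmas (NEW) -/

/-- LACUNARY FRAME of level `L`: `ξ = (P, Q, R)` with `P > L²`, `Q > 2LP`, `R > 2L(P+Q)` (all positive). -/
def IsLacunary (L : ℕ) (ξ : Fin 3 → ℤ) : Prop :=
  (L : ℤ) ^ 2 < ξ 0 ∧ 2 * (L : ℤ) * ξ 0 < ξ 1 ∧ 2 * (L : ℤ) * (ξ 0 + ξ 1) < ξ 2

/-- The explicit lacunary vector `ξ_L := (L²+1, 2L(L²+1)+1, 2L(L²+1 + 2L(L²+1)+1)+1)`. -/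
def lacXi (L : ℕ) : Fin 3 → ℤ :=
  ![(L : ℤ) ^ 2 + 1, 2 * L * ((L : ℤ) ^ 2 + 1) + 1,
    2 * L * (((L : ℤ) ^ 2 + 1) + (2 * L * ((L : ℤ) ^ 2 + 1) + 1)) + 1]

theorem isLacunary_lacXi (L : ℕ) : IsLacunary L (lacXi L) := by
  refine ⟨?_, ?_, ?_⟩ <;> simp [lacXi] 

/-- **Lacunary non-resonance (PROVED).** In a lacunary frame every nonzero mode of Euclidean size `≤ L` satisfies
`k·k < 2|k·ξ|` — by `resonanceCriterion` this says that no mode line `k + ℤξ` of a degree-`L` force is resonant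
for the Squire-reduced Rayleigh operator at `c = 0`, and quantitatively every integer-normalised eigenvalue
`I_j = ξ·ξ(1−j²) − k·k − 2j k·ξ` is a NONZERO integer, whence `‖((∂_θ+iρ)²+ω²)⁻¹‖ ≤ ξ·ξ/(4π²)`. -/
theorem lacunary_nonresonant {L : ℕ} {ξ k : Fin 3 → ℤ} (hξ : IsLacunary L ξ)
    (hk : k ≠ 0) (hkL : k ⬝ᵥ k ≤ (L : ℤ) ^ 2) : k ⬝ᵥ k < 2 * |k ⬝ᵥ ξ| := by
  obtain ⟨h0, h1, h2⟩ := hξ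
  have hkk : k ⬝ᵥ k = k 0 * k 0 + k 1 * k 1 + k 2 * k 2 := by
    simp [dotProduct, Fin.sum_univ_three]
  have hkξ : k ⬝ᵥ ξ = k 0 * ξ 0 + k 1 * ξ 1 + k 2 * ξ 2 := by
    simp [dotProduct, Fin.sum_univ_three]
  have hL : (0 : ℤ) ≤ L := by positivity
  have hP : 0 < ξ 0 := lt_of_le_of_lt (by positivity) h0
  have hQ : 0 < ξ 1 := by nlinarith
  have hR : 0 < ξ 2 := by nlinarith
  -- coordinate bounds |k i| ≤ L from k·k ≤ L²
  have hb0 : k 0 * k 0 ≤ (L : ℤ) ^ 2 := by nlinarith [mul_self_nonneg (k 1), mul_self_nonneg (k 2)]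
  have hb1 : k 1 * k 1 ≤ (L : ℤ) ^ 2 := by nlinarith [mul_self_nonneg (k 0), mul_self_nonneg (k 2)]
  have hb2 : k 2 * k 2 ≤ (L : ℤ) ^ 2 := by nlinarith [mul_self_nonneg (k 0), mul_self_nonneg (k 1)]
  have ha0 : |k 0| ≤ L := abs_le_of_sq_le_sq (by nlinarith [hb0]) hL
  have ha1 : |k 1| ≤ L := abs_le_of_sq_le_sq (by nlinarith [hb1]) hL
  have ha2 : |k 2| ≤ L := abs_le_of_sq_le_sq (by nlinarith [hb2]) hL
  rw [hkk] at hkL ⊢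
  rw [hkξ]
  by_cases hk2 : k 2 = 0
  · by_cases hk1 : k 1 = 0
    · have hk0 : k 0 ≠ 0 := by
        intro h; apply hk; ext i; fin_cases i <;> simp [h, hk1, hk2]
      simp only [hk1, hk2, mul_zero, zero_mul, add_zero]
      have h1le : 1 ≤ |k 0| := Int.one_le_abs hk0
      have : k 0 * k 0 < 2 * |k 0 * ξ 0| := by
        rw [abs_mul, abs_of_pos hP]
        have hkk0 : k 0 * k 0 = |k 0| * |k 0| := (abs_mul_abs_self (k 0)).symm
        rw [hkk0]
        nlinarith
      linarith
    · simp only [hk2, mul_zero, zero_mul, add_zero]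
      have h1le : 1 ≤ |k 1| := Int.one_le_abs hk1
      -- |k0 P + k1 Q| ≥ |k1| Q − |k0| P ≥ Q − L P > L P ≥ ... > L² ≥ k·k
      have hlow : |k 1| * ξ 1 - |k 0| * ξ 0 ≤ |k 0 * ξ 0 + k 1 * ξ 1| := by
        have := abs_sub_abs_le_abs_sub (k 1 * ξ 1) (-(k 0 * ξ 0))
        rw [abs_neg, abs_mul, abs_mul, abs_of_pos hQ, abs_of_pos hP, sub_neg_eq_add, add_comm] at this
        linarith
      have : (L : ℤ) ^ 2 < |k 0 * ξ 0 + k 1 * ξ 1| := by nlinarith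
      nlinarith [abs_nonneg (k 0 * ξ 0 + k 1 * ξ 1)]
  · have h1le : 1 ≤ |k 2| := Int.one_le_abs hk2
    have hlow : |k 2| * ξ 2 - (|k 0| * ξ 0 + |k 1| * ξ 1) ≤ |k 0 * ξ 0 + k 1 * ξ 1 + k 2 * ξ 2| := by
      have h := abs_sub_abs_le_abs_sub (k 2 * ξ 2) (-(k 0 * ξ 0 + k 1 * ξ 1))
      have htri : |k 0 * ξ 0 + k 1 * ξ 1| ≤ |k 0| * ξ 0 + |k 1| * ξ 1 := by
        calc |k 0 * ξ 0 + k 1 * ξ 1| ≤ |k 0 * ξ 0| + |k 1 * ξ 1| := abs_add_le _ _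
          _ = |k 0| * ξ 0 + |k 1| * ξ 1 := by rw [abs_mul, abs_mul, abs_of_pos hP, abs_of_pos hQ]
      rw [abs_neg, abs_mul, abs_of_pos hR, sub_neg_eq_add, add_comm (k 2 * ξ 2)] at h
      linarith
    have : (L : ℤ) ^ 2 < |k 0 * ξ 0 + k 1 * ξ 1 + k 2 * ξ 2| := by nlinarith
    nlinarith [abs_nonneg (k 0 * ξ 0 + k 1 * ξ 1 + k 2 * ξ 2)]

/-- RESONANCE CRITERION (statement; three-line proof in LACUNARY-FRAME-r2-5 §2): the Squire-reduced operator
`(∂_θ + iρ_ℓ)² + ω_ℓ²` of the line `k + ℤξ` (`ρ_ℓ = 2π(k·ξ)/ξ·ξ`, `ω_ℓ² = 4π²(1 − |k_⊥|²/ξ·ξ)`) has a kernel iff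
`∃ t ∈ ℤ, ξ·ξ(1 − t²) = k·k + 2t(k·ξ)` (TRIAGE-r1-3 (Y2a): "some lattice point of the line has length `|ξ|`"),
and once `ξ·ξ > 4 k·k` only `t = ±1` can occur, i.e. resonance ⟺ `k·k = 2|k·ξ|`. -/
def ResonanceCriterion : Prop :=
  ∀ (ξ k : Fin 3 → ℤ), 4 * (k ⬝ᵥ k) < ξ ⬝ᵥ ξ →
    ((∃ t : ℤ, (ξ ⬝ᵥ ξ) * (1 - t ^ 2) = k ⬝ᵥ k + 2 * t * (k ⬝ᵥ ξ)) ↔ k ⬝ᵥ k = 2 * |k ⬝ᵥ ξ|)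

/-- Integer cross product (avoids notation). -/
def cross3 (a b : Fin 3 → ℤ) : Fin 3 → ℤ :=
  ![a 1 * b 2 - a 2 * b 1, a 2 * b 0 - a 0 * b 2, a 0 * b 1 - a 1 * b 0]

/-- The explicit streamwise lattice direction `e_L := a·(Q,−P,0) + (R,0,−P)`,
`a := L·(P+Q+R)·(Q+R+2P) + 1` (any `a > L·|ξ|·(|v₁|+|v₂|)` works). -/
def lacE (L : ℕ) : Fin 3 → ℤ :=
  let ξ := lacXi L
  let a : ℤ := L * (ξ 0 + ξ 1 + ξ 2) * (ξ 1 + ξ 2 + 2 * ξ 0) + 1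
  ![a * ξ 1 + ξ 2, -(a * ξ 0), -(ξ 0)]

/-- EXPLICIT ADMISSIBLE FRAME (statement; two-line proof in the memo §2): `ξ_L ⊥ e_L`, and every off-line
mode of Euclidean size `≤ L` is admissible for the frame `(ξ_L, e_L)`: `k·e ≠ 0` (no mode on the plane `e^⊥`)
and `k·(ξ×e) ≠ 0` (none on `n^⊥`); moreover `ξ·ξ > L²`, so NO nonzero mode of size `≤ L` lies on the shear line
`ℤξ` (the one genuinely inadmissible set, TRIAGE-r1-1 (ii)). With `lacunary_nonresonant`: every mode of a
degree-`L` force is admissible AND non-resonant in ONE explicit frame of size `|ξ_L| ≤ 64 L⁴`, `|e_L| ≤ poly(L)`. -/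
def ExplicitAdmissibleFrame : Prop :=
  ∀ L : ℕ, 1 ≤ L →
    lacXi L ⬝ᵥ lacE L = 0 ∧
    ∀ k : Fin 3 → ℤ, k ≠ 0 → k ⬝ᵥ k ≤ (L : ℤ) ^ 2 →
      k ⬝ᵥ lacE L ≠ 0 ∧ k ⬝ᵥ cross3 (lacXi L) (lacE L) ≠ 0 ∧ ∀ m : ℤ, k ≠ m • lacXi L

/-! ## §C  The shear of a lattice frame and the frame-generic response statements (NEW) -/

/-- Real unit vector of an integer direction. -/
def unitVec (e : Fin 3 → ℤ) : E³ :=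
  (Real.sqrt ((WithLp.toLp 2 fun j => (e j : ℝ) : E³) ⬝ᵥ (WithLp.toLp 2 fun j => (e j : ℝ) : E³)))⁻¹ •
    (WithLp.toLp 2 fun j => (e j : ℝ))

/-- The Kolmogorov shear of the lattice frame `(ξ, e)`: `U_{ξ,e}(x) = sin(2π ξ·x) e/|e|`
(`= Re[(−i/2)e^{2πiξ·x} + (i/2)e^{−2πiξ·x}] ê`), an exact steady Euler shear when `ξ·e = 0`
(`(U·∇)U = sin·(ê·∇)sin(2πξ·x) ê = 0`), mean-zero, solenoidal, `‖U‖² = ½`, `‖∇U‖² = 2π² ξ·ξ`. -/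
def shearField (ξ e : Fin 3 → ℤ) : 𝕋³ → E³ :=
  Torus.realTrigPoly ({ξ, -ξ} : Finset (Fin 3 → ℤ))
    (fun k => if k = ξ then (-(Complex.I / 2)) • EuclideanSpace.complexify (unitVec e)
      else (Complex.I / 2) • EuclideanSpace.complexify (unitVec e))

structure IsEulerShear (U : 𝕋³ → E³) : Prop where
  smooth : Torus.IsSmooth U
  divFree : Torus.IsDivFree U
  zeroMean : Torus.HasZeroMean U
  trigPoly : ∃ d : ℕ, Torus.fourierTruncate d U = U
  selfAdvection : ∀ x, Torus.convect U U x = 0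

/-- (S) The frame shear is an Euler shear orthogonal to every force with no mode at `±ξ`. -/
def ShearFieldFacts : Prop :=
  ∀ ξ e : Fin 3 → ℤ, ξ ≠ 0 → e ≠ 0 → ξ ⬝ᵥ e = 0 →
    IsEulerShear (shearField ξ e) ∧
    ∀ f : 𝕋³ → E³, Torus.IsSmooth f →
      mFourierCoeff (EuclideanSpace.complexify ∘ f) ξ = 0 →
      mFourierCoeff (EuclideanSpace.complexify ∘ f) (-ξ) = 0 →
      (∫ x, ⟪shearField ξ e x, f x⟫_ℝ) = 0

/-- Wiener-type size of the resolved part of a force: `Σ_{k·k ≤ L²} ‖f̂(k)‖`. -/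
def wienerNorm (L : ℕ) (f : 𝕋³ → E³) : ℝ :=
  ∑ k ∈ Torus.freqBall L, ‖mFourierCoeff (EuclideanSpace.complexify ∘ f) k‖

/-- **THEOREM B IN AN ARBITRARY ADMISSIBLE LATTICE FRAME** (statement; replaces stubs 3 AND 4 of the negative
skeleton): for any lattice frame `ξ ⊥ e` and any polynomial force all of whose modes are admissible
(`k·e ≠ 0 ≠ k·(ξ×e)`; NO non-resonance hypothesis — resonant `t = ±1` lines and `μ̃ = 0` lines carry one extra
free constant and one extra solvability condition and are solvable, as the `3 × 3` layer system of the memo §3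
and the numerics (cases D, M) show), the shear `U_{ξ,e}` carries an approximate linear response. Per mode line:
the coordinate-free system `(x) iσX + S'_e Y + iαQ = F_e`, `(ξ) iσY + DQ = F_ξ`, `(n) iσZ + iζQ = F_n`,
`(d) iαX + DY + iζZ = 0` with `σ = α S`, `S = sin 2πθ`, `D = |ξ|(∂_θ + iρ_ℓ)`, reduces (Squire) to
`S(D²Y − k²Y) − S''Y = r`; `Y = 𝒢[PV(r/S) + λ₀δ₀ + λ_½δ_½]`, the single `L²`-admissibility condition per layer
`Y(θ_c) = β_c` (the combination `αN_x + ζN_z` vanishes identically — memo §3, the same cancellation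
`κ − α = ζ²/α` as DRESSED-RAY §3.3), log layers, `|X̂(j)| ≍ 1/j`, `|Ŷ(j)| ≍ 1/j²`, (R4) `O(1/K²)`, (R5) `O(log K)`. -/
def GeneralFrameResponseStatement : Prop :=
  ∀ ξ e : Fin 3 → ℤ, ξ ≠ 0 → e ≠ 0 → ξ ⬝ᵥ e = 0 →
    ∀ f : 𝕋³ → E³, Torus.IsSmooth f → Torus.IsDivFree f → Torus.HasZeroMean f →
      (∃ d : ℕ, Torus.fourierTruncate d f = f) →
      (∀ k : Fin 3 → ℤ, mFourierCoeff (EuclideanSpace.complexify ∘ f) k ≠ 0 →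
        k ⬝ᵥ e ≠ 0 ∧ k ⬝ᵥ cross3 ξ e ≠ 0) →
      ApproxLinearResponse f (shearField ξ e)

/-- **QUANTITATIVE RESPONSE IN THE EXPLICIT LACUNARY FRAME** (statement; THE load-bearing lemma of THEOREM C):
absolute `A, p` such that every admissible degree-`L` force has an approximate linear response around
`U_L := shearField (lacXi L) (lacE L)` with constant `≤ A·(L·(1 + wienerNorm L f))^p`. Why polynomial: the frame
has `|ξ_L| ≤ 64L⁴`, `|e_L| ≤ poly(L)`; divisors `α = 2πk·e/|e| ≥ 2π/|e_L|`, `ζ ≥ 2π/|n_L|`; by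
`lacunary_nonresonant` every integer eigenvalue numerator `I_j ≠ 0`, so `‖T_ℓ⁻¹‖ ≤ ξ·ξ/4π²` and the layer
determinant `(cos ω_ℓ − cos ρ_ℓ)/(2cos²(ω_ℓ/2)) ≥ c/(ξ·ξ)²` UNIFORMLY over the `≤ (2L+1)³` lines; no
exponentials occur (cosh regime absent: `|k_⊥| < |ξ|` on every line). -/
def QuantitativeLacunaryResponseStatement : Prop :=
  ∃ A p : ℕ, ∀ L : ℕ, 1 ≤ L →
    ∀ f : 𝕋³ → E³, Torus.IsSmooth f → Torus.IsDivFree f → Torus.HasZeroMean f →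
      Torus.fourierTruncate L f = f →
      ApproxLinearResponseWith f (shearField (lacXi L) (lacE L))
        ((A : ℝ) * ((L : ℝ) * (1 + wienerNorm L f)) ^ p)

/-- **UNIVERSAL RAY** (statement; the `ν`-dependent-frame bookkeeping = THEOREM C proper, now M-sized given the
quantitative response): for EVERY admissible force (polynomial or not) and every `β ≤ 3/4`, `RayFamily β f`.
Recipe (memo §4): given `(C, Θ, ε, ν₀)` pick `σ := 1/(200(p+1))`, `ν` small, `L := ⌈ν^{-σ}⌉`, split
`f = P_L f + f_>` (`‖f̂_>‖_{ℓ¹} = O(L^{-m}) ∀m` by smoothness — goes into `den` and `τ`), respond to `P_L f` in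
the frame `(ξ_L, e_L)` with `C_b ≤ A(L(1+‖f̂‖_{ℓ¹}))^p = ν^{-O(σ)}`, normalise the shear amplitude by `|ξ_L|`
(`a := (A₀/|ξ_L|)ν^{-3/8}U_L + (|ξ_L|/A₀)ν^{3/8} b_K`, so `D_a = 2π²A₀²ν^{1/4}`, `νK_a = A₀ν^{5/8}` are
`|ξ|`-free), `K := ⌈ν^{-7/10}⌉`; then `den ≲ ν^{5/8−O(σ)}`, price `≲ (1+2Θ)C²ν^{-1/2}`, `den·price ≲ ν^{1/8−O(σ)} → 0`,
room in the ball, `(a,f) = (|ξ_L|/A₀)ν^{3/8}(b_K, f) + (A₀/|ξ_L|)ν^{-3/8}(U_L, f_>) = O(ν^{3/8−O(σ)})`. -/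
def UniversalRayStatement : Prop :=
  QuantitativeLacunaryResponseStatement →
    ∀ f : 𝕋³ → E³, Torus.IsSmooth f → Torus.IsDivFree f → Torus.HasZeroMean f →
      ∀ β : ℝ, β ≤ 3 / 4 → RayFamily β f

/-- **Composition (PROVED logic): the crux is refuted BY NAME from THEOREM A's endgame (stub 1 of the registered
negative skeleton), the universal-ray bookkeeping and the quantitative lacunary response** — stubs 3, 4, 5 of
`Lines/dressed-laminar-ray.lean` (axis frames / skew frames / `ν`-dependent frames) are replaced by ONE
frame-generic response lemma in ONE explicit frame. -/
theorem kolmogorovFloor_false_of_lacunary (h1 : EndgameStatement) (hU : UniversalRayStatement)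
    (hQ : QuantitativeLacunaryResponseStatement) : ¬ KolmogorovFloor :=
  not_kolmogorovFloor_of_kill fun f hfs hfd hfz => h1 _ f hfs hfd hfz (hU hQ f hfs hfd hfz (3 / 4) le_rfl)

/-- Per-force form for tenure's KILL CRITERION: no admissible force whatsoever witnesses any class `β ≤ 3/4`. -/
theorem floorClassAtFor_false_of_lacunary (h1 : EndgameStatement) (hU : UniversalRayStatement)
    (hQ : QuantitativeLacunaryResponseStatement) {β : ℝ} (hβ : β ≤ 3 / 4) {f : 𝕋³ → E³}
    (hfs : Torus.IsSmooth f) (hfd : Torus.IsDivFree f) (hfz : Torus.HasZeroMean f) : ¬ FloorClassAtFor β f :=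
  not_floorClassAtFor_of_kill (h1 β f hfs hfd hfz (hU hQ f hfs hfd hfz β hβ))

/-! ## §D  The fixed-frame corollary for the "empty axis" class (ν-independent constants) -/

/-- The `√2`-polarised Kolmogorov shear `sin(2πx₂)·(e₁ + √2 e₃)/√3` — a smooth steady Euler shear whose ONLY
inadmissible modes are those on the axis `ℤe₂` (`α = 2π(k₁ + √2k₃)/√3`, `ζ = 2π(√2k₁ − k₃)/√3`... up to sign,
both `≠ 0` off the axis with `|k₁ + √2 k₃| ≥ 1/(|k₁| + √2|k₃|)` since `k₁² − 2k₃²` is a nonzero integer). -/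
def shearSqrtTwo : 𝕋³ → E³ :=
  Torus.realTrigPoly ({Pi.single 1 1, -Pi.single 1 1} : Finset (Fin 3 → ℤ))
    (fun k => (if k = Pi.single 1 1 then -(Complex.I / 2) else Complex.I / 2) •
      EuclideanSpace.complexify (WithLp.toLp 2 ![1 / Real.sqrt 3, 0, Real.sqrt 2 / Real.sqrt 3]))

/-- **EMPTY-AXIS KILL** (statement): every smooth admissible force whose Fourier transform vanishes on the axis
`ℤe₂` (equivalently `∫∫ f dx₁dx₃ ≡ 0`; a NON-polynomial class of infinite dimension and codimension) is killed in
the FIXED frame `shearSqrtTwo` with `ν`-INDEPENDENT response constants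
(`C_b ≤ Σ_k ‖f̂(k)‖·poly(|k|) < ∞`: all off-axis lines with `k₁²+k₃² ≥ 2` are in the cosh regime, the four
`μ̃ = 0` lines `k₁²+k₃² = 1` are solvable by the 3×3 system of the memo §3), hence `FloorKillAtFor β f` for every
`β ≤ 3/4` by THEOREM A — no `ν`-dependent frame, no THEOREM C. The cheapest conclusive Lean landing between "one
explicit `f₀`" and "all `f`". Contrapositive ("cokernel law"): a witness force of `KolmogorovFloor` must charge
EVERY rational line through the origin. -/
def EmptyAxisKillStatement : Prop :=
  ∀ f : 𝕋³ → E³, Torus.IsSmooth f → Torus.IsDivFree f → Torus.HasZeroMean f →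
    (∀ m : ℤ, mFourierCoeff (EuclideanSpace.complexify ∘ f) (Pi.single 1 m) = 0) →
    0 < (∫ x, ‖f x‖ ^ 2) →
    ApproxLinearResponse f shearSqrtTwo ∧ ∀ β : ℝ, β ≤ 3 / 4 → RayFamily β f

theorem emptyAxis_floorClass_false (h1 : EndgameStatement) (hE : EmptyAxisKillStatement) {β : ℝ}
    (hβ : β ≤ 3 / 4) {f : 𝕋³ → E³} (hfs : Torus.IsSmooth f) (hfd : Torus.IsDivFree f)
    (hfz : Torus.HasZeroMean f)
    (hline : ∀ m : ℤ, mFourierCoeff (EuclideanSpace.complexify ∘ f) (Pi.single 1 m) = 0)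
    (hf0 : 0 < ∫ x, ‖f x‖ ^ 2) : ¬ FloorClassAtFor β f :=
  not_floorClassAtFor_of_kill (h1 β f hfs hfd hfz ((hE f hfs hfd hfz hline hf0).2 β hβ))

end Summit.AnomalousDissipation.AnomalousDissipation.Cruxes.KolmogorovFloor.Ideate5

end
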